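import Literature.NumberTheory.Rogawski1990.KottwitzSignLocalFlip
import Literature.NumberTheory.Rogawski1990.KottwitzSignReadsObs
import HarnessLib

/-!
# Kottwitz's sign IS the endoscopic character on the self-carrier — the LETTER-FREE head: `e_𝐀(q) = (−1)^{obs_s(q)}` on `𝒞′_𝐀(γ₀)`
# (Rogawski 1990, §4.1 (4.1.2) pp. 39–40, §5.4 (5.4.2)–(5.4.3) pp. 72–73; Kottwitz 1983 §1; Kottwitz 1986 §9)

Topic `NumberTheory/Rogawski1990`; namespace `Literature.NumberTheory.Rogawski1990`. ONE THEOREM over accepted tree modules: no definition, no named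
fact, no instance, no notation, no `sorry`. Cell `pub/hodgecm-mathlib`, ENGINE T1 (crux H413 = `stmt-HodgeConjecture-24833`), O7 row (d) «THE SIGN WEIGHT
READS THE OBSTRUCTION» (O7 OWNER WORDS #41∕#43∕#46∕#49 (2)) — the composition of A-p17 (g16)'s LOCAL FLIPS ★ `KottwitzSignLocalFlip`
(`kottwitzSignLocal_toLocal_adele_eq` at the finite places, `kottwitzSignAt_archPart_adele_eq` at the complex places) with A-p18 (g20)'s ASSEMBLY ★
`KottwitzSignReadsObs` (`kottwitzSignWeight_eq_of_singularObs_of_localFlip`): for a rational split-singular non-central `γ₀ ∈ U(H)(L⁺)` and every `q` in its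
adelic stable class, `kottwitzSignWeight ⟦q.adele⟧ = if obs_s(q) = 0 then 1 else −1` — the T1b-nonreg closer's hypothesis `SignWeightReadsObs (kottwitzSignWeight L 3 H)`
(A-p16 (g21) :371) VERBATIM, now letter-free.

## References
* [Rogawski1990] J. D. Rogawski, *Automorphic Representations of Unitary Groups in Three Variables*, Ann. of Math. Stud. 123 (1990), §3.8 Prop. 3.8.1 p. 37;
  §4.1 (4.1.2) pp. 39–40; §5.4 pp. 72–73; §14.5 p. 239.
* [Kottwitz1983] R. E. Kottwitz, *Sign changes in harmonic analysis on reductive groups*, Trans. AMS 278 (1983), 289–297, §1.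
* [Kottwitz1986] R. E. Kottwitz, *Stable trace formula: elliptic singular terms*, Math. Ann. 275 (1986), §9.
-/

set_option autoImplicit false

noncomputable section

open NumberField NumberField.InfinitePlace IsDedekindDomain Matrix
open scoped MatrixGroups

namespace Literature.NumberTheory.Rogawski1990

open Literature.NumberTheory.Automorphic
open Literature.AlgebraicGeometry.ShimuraVarieties (unitaryGroup)

variable {L : Type} [Field L] [NumberField L] [IsCMField L] {H : Matrix (Fin 3) (Fin 3) L}

/-- **(d) «KOTTWITZ'S SIGN IS THE ENDOSCOPIC CHARACTER ON THE SELF-CARRIER»** (letter-free): for `H` hermitian non-degenerate, every rational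
split-singular non-central `γ₀ ∈ U(H)(L⁺)` (`(γ₀ − a)(γ₀ − b) = 0`, `a ≠ b` unitary scalars, `γ₀` not scalar) and every `q ∈ 𝒞′_𝐀(γ₀)`,
`kottwitzSignWeight ⟦q.adele⟧ = if obs_s(q) = 0 then 1 else −1` — ★ `kottwitzSignWeight_eq_of_singularObs_of_localFlip` fed with the local flips ★
`kottwitzSignLocal_toLocal_adele_eq` ∕ ★ `kottwitzSignAt_archPart_adele_eq`. Text = A-p16 (g21)'s `SignWeightReadsObs (kottwitzSignWeight L 3 H)` body.
[cite: Rogawski1990, §4.1 (4.1.2) pp. 39–40; §5.4 (5.4.2)–(5.4.3) pp. 72–73; §3.8 Prop. 3.8.1 (d) p. 37] [cite: Kottwitz1983, §1] [cite: Kottwitz1986, §9] -/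
theorem kottwitzSignWeight_eq_of_singularObs (hH : (H.map (cmConjRingHom L))ᵀ = H) (hdet : H.det ≠ 0) :
    ∀ (γ₀ : (UnitaryGroup.cmDatum L 3 H).Rational) (a b : L) (hab : a ≠ b), cmConjRingHom L a * a = 1 → cmConjRingHom L b * b = 1 →
    ∀ (hγ₀ : (((γ₀.val : GL (Fin 3) L) : Matrix (Fin 3) (Fin 3) L) - a • (1 : Matrix (Fin 3) (Fin 3) L)) *
      (((γ₀.val : GL (Fin 3) L) : Matrix (Fin 3) (Fin 3) L) - b • (1 : Matrix (Fin 3) (Fin 3) L)) = 0),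
    (¬ ∃ ζ : L, ((γ₀.val : GL (Fin 3) L) : Matrix (Fin 3) (Fin 3) L) = ζ • (1 : Matrix (Fin 3) (Fin 3) L)) →
    ∀ q : MatchingAdeleG₂ L H H γ₀,
      kottwitzSignWeight L 3 H (ConjClasses.mk q.adele) = if q.singularObs hab hγ₀ = 0 then 1 else -1 :=
  kottwitzSignWeight_eq_of_singularObs_of_localFlip hH hdet
    (fun hab ha hb hγ₀ hα hβ q _ hg W hW v => kottwitzSignLocal_toLocal_adele_eq hH hdet hab ha hb hγ₀ hα hβ q hg W hW v)
    (fun hab ha hb hγ₀ hα hβ q _ hg W hW w => kottwitzSignAt_archPart_adele_eq hH hdet hab ha hb hγ₀ hα hβ q hg W hW w)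

end Literature.NumberTheory.Rogawski1990

end
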